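import Literature.Barriers.RiemannHypothesis.JensenPolynomialsSqrtMixed
import Literature.Analysis.Complex.JensenLaguerreFlow
import Summits.RiemannHypothesis.RiemannHypothesis.Theorems.Splittings.JointPoly
import HarnessLib

/-!
# Splittings / Jensen — X-4's conjuncts SEPARATE at class level: `A(M) ∧ ¬B(M)` for the caveat witness
# `M(w) = cosh √w + 2 cosh (√w/20)` (bridge-lens corollary of `JensenPolynomialsSqrtMixed`)

Cell rh-split, seat rh-split-jen-bridge gen 3 (§8 of `HOME/rh-split-jen-bridge/SketchG3.lean`, FROZEN sha16
56ebb7b3456d0835; card `cards/SPLIT-jen-bridge.md` §10); zero-def Splittings file by rh-split-typer-1 g3 (referee g2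
01:19:41Z: «§8 x4_analogue_separates ONLY under Theorems/Splittings, since it imports JointPoly»).

Tree X-4 (`Theorems/Splittings/JensenDerivativeLaguerre.lean`): `RH ⟺ A ∧ B` with A = «rows `n ≥ 1` hyperbolic»,
B = «strict Laguerre sign law `J·J″ < 0` at the real critical points of every `J^{d,0}`, `d ≥ 2`, off its zeros»,
glued by the RH-free polynomial lemma `JointPoly.splits_of_derivative_splits_of_laguerre`.  For the caveat witness
`M = coshSqrtMix` of `Literature.Barriers.RiemannHypothesis.JensenPolynomialsSqrtMixed` the A-analogue HOLDS
(`splits_jensenPoly_coshSqrtMix`) and — by the same glue, contrapositively — the B-analogue FAILS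
(`exists_rowZeroLaguerre_fails_coshSqrtMix`): so on the class of real entire functions of order `< 1` with positive
Taylor coefficients (even with infinitely many real zeros) A does not imply B (`x4_analogue_separates`); any proof
of `A ⟹ B` for `Ξ` must use `ξ`-specific input.  Bookkeeping about the SHAPE of X-4; class UNCHANGED; not a claim
about RH.

HONEST LABEL: «SPLITTING SEARCH over kernel-typed RH-EQUIVALENCES; a splitting A ∧ B ⟹ RH is CONDITIONAL
bookkeeping unless A and B are both proved; nothing here bears on the truth of RH.»
-/

set_option linter.dupNamespace false

noncomputable section

open Complex Polynomial Filter Topology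
open scoped Nat Real ComplexConjugate

namespace Summit.RiemannHypothesis.RiemannHypothesis.Theorems.Splittings.JensenX4ClassSeparation

open Literature.Barriers.RiemannHypothesis Literature.Barriers.RiemannHypothesis.CoshSqrtMix
open Literature.NumberTheory.LFunctions (jensenPoly)

/-- For the caveat witness, the strict Laguerre sign law on row `0` FAILS for some `d ≥ 2`: there is a real
critical point `x` of `J^{d,0}(M)`, not a zero, with `J(x)·J″(x) ≥ 0` — although every row `n ≥ 1` is hyperbolic.
[cite: Farmer2022, §4] -/
theorem exists_rowZeroLaguerre_fails_coshSqrtMix :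
    ∃ d : ℕ, 2 ≤ d ∧ ∃ x : ℝ, (derivative (jensenPoly (taylorCoeffSeq coshSqrtMix) d 0)).eval x = 0 ∧
      (jensenPoly (taylorCoeffSeq coshSqrtMix) d 0).eval x ≠ 0 ∧
      0 ≤ (jensenPoly (taylorCoeffSeq coshSqrtMix) d 0).eval x *
        (derivative (derivative (jensenPoly (taylorCoeffSeq coshSqrtMix) d 0))).eval x := by
  obtain ⟨d, hd⟩ := exists_not_splits_jensenPoly_coshSqrtMix_zero
  rcases Nat.lt_or_ge d 2 with h2 | h2
  · exact absurd (Splits.of_natDegree_le_one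
      ((Literature.NumberTheory.LFunctions.natDegree_jensenPoly_le _ d 0).trans (by omega))) hd
  obtain ⟨e, rfl⟩ := Nat.exists_eq_add_of_le' h2
  by_contra hB
  push Not at hB
  apply hd
  refine Summit.RiemannHypothesis.RiemannHypothesis.Theorems.Splittings.JointPoly.splits_of_derivative_splits_of_laguerre
    _ ?_ (hB (e + 2) (by omega))
  rw [Literature.Analysis.Complex.JensenLaguerreFlow.derivative_jensenPoly_succ]
  exact (splits_jensenPoly_coshSqrtMix (n := 0 + 1) (by norm_num) (e + 1)).C_mul _

/-- The X-4 conjunct analogues SEPARATE on the class: `A(M) ∧ ¬B(M)` for the caveat witness `M`. Bookkeeping about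
the shape of X-4; not a claim about RH. [cite: Farmer2022, §4] -/
theorem x4_analogue_separates :
    (∀ d n : ℕ, 1 ≤ n → (jensenPoly (taylorCoeffSeq coshSqrtMix) d n).Splits) ∧
    ¬ (∀ d : ℕ, 2 ≤ d → ∀ x : ℝ, (derivative (jensenPoly (taylorCoeffSeq coshSqrtMix) d 0)).eval x = 0 →
        (jensenPoly (taylorCoeffSeq coshSqrtMix) d 0).eval x ≠ 0 →
        (jensenPoly (taylorCoeffSeq coshSqrtMix) d 0).eval x *
          (derivative (derivative (jensenPoly (taylorCoeffSeq coshSqrtMix) d 0))).eval x < 0) := by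
  refine ⟨fun d n hn ↦ splits_jensenPoly_coshSqrtMix hn d, fun hB ↦ ?_⟩
  obtain ⟨d, hd, x, h1, h2, h3⟩ := exists_rowZeroLaguerre_fails_coshSqrtMix
  exact absurd (hB d hd x h1 h2) (not_lt.2 h3)

end Summit.RiemannHypothesis.RiemannHypothesis.Theorems.Splittings.JensenX4ClassSeparation

end
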